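import Mathlib
import Summits.KontsevichZagierPeriods.Zeta5Search.PeriodicCellKit
import HarnessLib

/-!
# ζ(5) search — PERIODIC CELL KIT IV: the window bounds of a table row, one generic theorem per LETTER (fam-denom g14)

HONEST FRAMING: systematic search; no irrationality claim unless certified.  Integer bookkeeping of net exponents of
the T1 ray C1 (`bRay β1 n`, `d = 64n`) below `θ = 1`; nothing here is an irrationality statement.

For a cell row `c : Cell` (`PeriodicCellKit`) with `cellOK c = true`, the level-class cover of `cover_of_cellOK` feeds the
ray-C1 guard theorems of `RayC1Levels` / `RayC1GuardsOI` (`ray1_LB`, `ray1_J`, `ray1_B`, `ray1_I`, `ray1_O`) through the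
`t`-free guard transfers `check*_pdec` of `ClassTypeGuardsPeriodic(I)`.  This file packages that plumbing ONCE PER LETTER:
`bound_LB`, `bound_J`, `bound_B`, `bound_I`, `bound_O` take the row, its kernel check, the letter's integer constants with
their `t`-free guard certificate (one Boolean, closed by `decide` in a class file), and the class window in the frozen
consumer shape `(u₂b₁+u₁)p + 2u₂(tp) < u₂n`, `v₂n < (v₂b₁+v₁)p + 2v₂(tp)`, and conclude `K ≤ v_p(Cas₇(b(n)))` for every
`K` below the letter's affine function of `t`.  A class file then states its bound with literal numbers and proves it by
ONE application (the class supplies `p_min ≤ p` from `86 ≤ p` and its literal window by `omega`).  Also `Ctx.facts`: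
`86 ≤ p`, `p` odd, `1 ≤ n`, `p ≤ 64n` from the window and `85n + 2 < p²`.
-/

open Finset

namespace Summit.KontsevichZagierPeriods.Zeta5Search.CellKit

open Summit.KontsevichZagierPeriods.Zeta5Search.ClusterValuation (netExp)
open Summit.KontsevichZagierPeriods.Zeta5Search.CasoratianValuation (casoratian)
open Summit.KontsevichZagierPeriods.Zeta5Search.ClassTypeCover
open Summit.KontsevichZagierPeriods.Zeta5Search.T1Rays (bRay β1)

/-- **Window facts**: `86 ≤ p`, `p` odd, `1 ≤ n`, `p ≤ 64n` from the lower window side (`u₂ ≥ 1`, `b₁ ≥ 1`), primality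
and `85n + 2 < p²`. -/
theorem Ctx.facts (C : Ctx) (hu : 1 ≤ C.u2) (hb : 1 ≤ C.b1) {n p t : ℕ} (hpr : p.Prime) (hsq : 85 * n + 2 < p ^ 2)
    (hA : (C.u2 * C.b1 + C.u1) * p + 2 * C.u2 * (t * p) < C.u2 * n) : 86 ≤ p ∧ p % 2 = 1 ∧ 1 ≤ n ∧ p ≤ 64 * n := by
  have h1 : C.u2 * p ≤ (C.u2 * C.b1 + C.u1) * p := by
    apply Nat.mul_le_mul_right; nlinarith
  have hnp : p ≤ n := by
    by_contra h
    have h2 : C.u2 * n < C.u2 * p := Nat.mul_lt_mul_of_pos_left (by omega) (by omega)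
    omega
  have hp : 86 ≤ p := by nlinarith
  have h2 : ¬ 2 ∣ p := fun h => by rcases hpr.eq_one_or_self_of_dvd 2 h with h' | h' <;> omega
  omega

section Letters

variable (c : Cell) (hc : cellOK c = true) (hu : 1 ≤ c.ctx.u2) (hb : 1 ≤ c.ctx.b1)
  {n p t : ℕ} (hpr : p.Prime) (hpar : n % 2 = c.ctx.a) (hsq : 85 * n + 2 < p ^ 2)
  (hA : (c.ctx.u2 * c.ctx.b1 + c.ctx.u1) * p + 2 * c.ctx.u2 * (t * p) < c.ctx.u2 * n)
  (hB : c.ctx.v2 * n < (c.ctx.v2 * c.ctx.b1 + c.ctx.v1) * p + 2 * c.ctx.v2 * (t * p))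
  (hpm : 86 ≤ p → c.ctx.pmin ≤ p)
include hc hu hb hpr hpar hsq hA hB hpm

/-- The cover of the row at shift index `t`, window in consumer shape. -/
theorem cover_tp : Cover (bRay β1 n) p (c.rc.map (pdec t)) := by
  haveI : Fact p.Prime := ⟨hpr⟩
  obtain ⟨hp, hp2, -, -⟩ := c.ctx.facts hu hb hpr hsq hA
  exact cover_of_cellOK c hc rfl hpar (hpm hp) hp2 hA hB

/-- **LETTER-FREE BOUND (THEOREM LB only)**: `checkLB` at `(minE, minE + 3)` sliding with slope `−256`;
`K ≤ 2·minE + 3 − 512t`. -/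
theorem bound_LB {minE : ℤ} (hm : minE ≤ -2)
    (hchk : pcheckLB (decide (c.ctx.a = 1)) c.rc (-256) minE (minE + 3) = true)
    {K : ℤ} (hK : K ≤ 2 * minE + 3 - 512 * t) (hne : casoratian (bRay β1 n) 7 ≠ 0) :
    K ≤ padicValRat p (casoratian (bRay β1 n) 7) := by
  obtain ⟨hp, hp2, hn1, hpd⟩ := c.ctx.facts hu hb hpr hsq hA
  have hcov := cover_tp c hc hu hb hpr hpar hsq hA hB hpm
  have hLB := checkLB_pdec hchk t
  exact ray1_LB hn1 hpr (by omega) hpd hsq hpar hcov hLB (by omega) (by omega) (by omega) hne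

/-- **LETTER J (lemma-D bonus)**: `checkLB` at `(minE, minE+3)`, `checkJ` at `minE`, `checkLBx` at `(minE; minE+1, minE+4)`,
all sliding with slope `−256`; `K ≤ 2·minE + 4 − 512t`. -/
theorem bound_J {minE : ℤ} (hm : minE ≤ -3)
    (hchk : (pcheckLB (decide (c.ctx.a = 1)) c.rc (-256) minE (minE + 3) && pcheckJ (decide (c.ctx.a = 1)) c.rc (-256) minE &&
      pcheckLBx (decide (c.ctx.a = 1)) c.rc (-256) minE (minE + 1) (minE + 4)) = true)
    {K : ℤ} (hK : K ≤ 2 * minE + 4 - 512 * t) (hne : casoratian (bRay β1 n) 7 ≠ 0) :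
    K ≤ padicValRat p (casoratian (bRay β1 n) 7) := by
  obtain ⟨hp, hp2, hn1, hpd⟩ := c.ctx.facts hu hb hpr hsq hA
  have hcov := cover_tp c hc hu hb hpr hpar hsq hA hB hpm
  simp only [Bool.and_eq_true] at hchk
  obtain ⟨⟨hLB0, hJ0⟩, hLBx0⟩ := hchk
  exact ray1_J hn1 hpr (by omega) hpd hsq hpar hcov (checkLB_pdec hLB0 t) (by omega) (checkJ_pdec hJ0 t)
    (checkLBx_pdec hLBx0 t) (by omega) (by omega) (by omega) (by omega) hne

/-- **LETTER B (double drop)**: `checkLB` at `(−N₀, −N₀+3)`, `checkLBx` at `(−N₀; −N₀+1, −N₀+4)` (slope `−256`), `checkB`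
at `N₀` (slope `256`), `N₀ ≥ 4` even; `K ≤ −2N₀ + 5 − 512t`. -/
theorem bound_B {N₀ : ℕ} (hN : 4 ≤ N₀) (hNe : N₀ % 2 = 0)
    (hchk : (pcheckLB (decide (c.ctx.a = 1)) c.rc (-256) (-(N₀ : ℤ)) (-(N₀ : ℤ) + 3) &&
      pcheckLBx (decide (c.ctx.a = 1)) c.rc (-256) (-(N₀ : ℤ)) (-(N₀ : ℤ) + 1) (-(N₀ : ℤ) + 4) &&
      pcheckB (decide (c.ctx.a = 1)) c.rc 256 N₀) = true)
    {K : ℤ} (hK : K ≤ -2 * (N₀ : ℤ) + 5 - 512 * t) (hne : casoratian (bRay β1 n) 7 ≠ 0) :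
    K ≤ padicValRat p (casoratian (bRay β1 n) 7) := by
  obtain ⟨hp, hp2, hn1, hpd⟩ := c.ctx.facts hu hb hpr hsq hA
  have hcov := cover_tp c hc hu hb hpr hpar hsq hA hB hpm
  simp only [Bool.and_eq_true] at hchk
  obtain ⟨⟨hLB0, hLBx0⟩, hB0⟩ := hchk
  have hLB := checkLB_pdec hLB0 t
  have hLBx := checkLBx_pdec hLBx0 t
  have e : -(N₀ : ℤ) + (-256) * (t : ℤ) = -((N₀ + 256 * t : ℕ) : ℤ) := by push_cast; ring
  rw [e] at hLB hLBx
  refine ray1_B hn1 hpr (by omega) hpd hsq hpar hcov (N := N₀ + 256 * t) (by omega) (Nat.even_iff.mpr (by omega)) hLB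
    (by omega) (checkB_pdec hB0 t) hLBx (by omega) ?_ ?_ (by omega) hne
  · omega
  · omega

/-- **LETTER I (law A3)**: `checkI` at `M₀` (slope `256`) with the palindromic minimal run word `R₀`, `M₀ ≥ 6` even;
`K ≤ 6 − 2M₀ − 512t`. -/
theorem bound_I {M₀ : ℕ} (hM : 6 ≤ M₀) (hMe : M₀ % 2 = 0) {R₀ : List Run}
    (hchk : (pcheckI (decide (c.ctx.a = 1)) c.rc 256 M₀ R₀ && decide (R₀.reverse = R₀)) = true)
    {K : ℤ} (hK : K ≤ 6 - 2 * (M₀ : ℤ) - 512 * t) (hne : casoratian (bRay β1 n) 7 ≠ 0) :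
    K ≤ padicValRat p (casoratian (bRay β1 n) 7) := by
  obtain ⟨hp, hp2, hn1, hpd⟩ := c.ctx.facts hu hb hpr hsq hA
  have hcov := cover_tp c hc hu hb hpr hpar hsq hA hB hpm
  simp only [Bool.and_eq_true, decide_eq_true_eq] at hchk
  obtain ⟨hI0, hpal⟩ := hchk
  refine ray1_I hn1 hpr (by omega) hpd hsq hpar hcov (M := M₀ + 256 * t) (by omega) (Nat.even_iff.mpr (by omega))
    (rdecode_palindrome hpal t) (checkI_pdec hI0 t) ?_ hne
  push_cast; omega

/-- **LETTER O (collinearity rung)**: `checkLB` at `(−N₀, −N₀+3)`, `checkLBx` at `(−N₀; −N₀+1, −N₀+4)` (slope `−256`),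
`checkO` at `N₀` (slope `256`) with the (≤ 2) minimal keys, `N₀ ≥ 3` odd, and the rung's moment range over the whole cell
`u₂(N₀ − 1) ≤ 128(u₂b₁ + u₁)`; `K ≤ −2N₀ + 4 − 512t`. -/
theorem bound_O {N₀ : ℕ} (hN : 3 ≤ N₀) (hNo : N₀ % 2 = 1) (hrng : c.ctx.u2 * (N₀ - 1) ≤ 128 * (c.ctx.u2 * c.ctx.b1 + c.ctx.u1))
    {K₁ K₂ : Bool × List Run}
    (hchk : (pcheckLB (decide (c.ctx.a = 1)) c.rc (-256) (-(N₀ : ℤ)) (-(N₀ : ℤ) + 3) &&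
      pcheckLBx (decide (c.ctx.a = 1)) c.rc (-256) (-(N₀ : ℤ)) (-(N₀ : ℤ) + 1) (-(N₀ : ℤ) + 4) &&
      pcheckO (decide (c.ctx.a = 1)) c.rc 256 N₀ K₁ K₂) = true)
    {K : ℤ} (hK : K ≤ -2 * (N₀ : ℤ) + 4 - 512 * t) (hne : casoratian (bRay β1 n) 7 ≠ 0) :
    K ≤ padicValRat p (casoratian (bRay β1 n) 7) := by
  obtain ⟨hp, hp2, hn1, hpd⟩ := c.ctx.facts hu hb hpr hsq hA
  have hcov := cover_tp c hc hu hb hpr hpar hsq hA hB hpm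
  simp only [Bool.and_eq_true] at hchk
  obtain ⟨⟨hLB0, hLBx0⟩, hO0⟩ := hchk
  have hLB := checkLB_pdec hLB0 t
  have hLBx := checkLBx_pdec hLBx0 t
  have hO := checkO_pdec hO0 t
  have e : -(N₀ : ℤ) + (-256) * (t : ℤ) = -((N₀ + 256 * t : ℕ) : ℤ) := by push_cast; ring
  rw [e] at hLB hLBx
  have hrangeO : (N₀ + 256 * t - 1) * p ≤ 128 * n + 1 := by
    have e0 : N₀ + 256 * t - 1 = (N₀ - 1) + 256 * t := by omega
    have h1 : c.ctx.u2 * ((N₀ - 1) * p) ≤ 128 * ((c.ctx.u2 * c.ctx.b1 + c.ctx.u1) * p) := by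
      rw [← mul_assoc, ← mul_assoc]; exact Nat.mul_le_mul_right p hrng
    have h2 : c.ctx.u2 * ((N₀ - 1 + 256 * t) * p) < c.ctx.u2 * (128 * n) := by
      have h3 : c.ctx.u2 * ((N₀ - 1 + 256 * t) * p) = c.ctx.u2 * ((N₀ - 1) * p) + 128 * (2 * c.ctx.u2 * (t * p)) := by ring
      rw [h3]; nlinarith
    rw [e0]
    have h4 := Nat.lt_of_mul_lt_mul_left h2
    omega
  refine ray1_O hn1 hpr (by omega) hpd hsq hpar hcov (N := N₀ + 256 * t) (by omega) (by omega) hrangeO hLB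
    (by omega) hO hLBx (by omega) ?_ ?_ (by omega) hne
  · push_cast; omega
  · omega

end Letters

end Summit.KontsevichZagierPeriods.Zeta5Search.CellKit
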